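import Summits.Ventures.CertifiedQuantumChemistry.Rows.ModelPin
import HarnessLib

/-!
# Ventures/CertifiedQuantumChemistry — Rows/ModelPinDiffKeys.lean: the DIFFERENCE row keys of record
# `dE@fcidump:<sha8A>-<sha8B>:Na<a>:Nb<b>` / `dE@fcidump:<sha8A>:Na<a>:Nb<b>-<sha8B>:Na<a'>:Nb<b'>`
# rendered from two `PinnedSector` records (sibling of `Rows/ModelPin.lean`, nothing there is edited)

HONEST FRAMING (verbatim, page 1 of every file of the cell): certified bounds for a stated model
Hamiltonian in a stated basis; not a claim about the real molecule or material beyond that model.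
CERTIFIED = inequalities on `E₀` (or `ΔE₀`) of files pinned by sha256 from replayed exact
certificates with typed soundness lemmas; VALIDATED = everything mapping model → reality.

Typer chem-type-01 (LADDER-CHEM cell chem-oracle, gen 2; sibling file for a referee bounce on I-TYPE
slot 10 (ii)), zero compute; two string-rendering definitions and their rendering lemmas; nothing is
asserted about any model, no claim node, no record of any pinned file, no instance, no notation.

WHY. `Rows/ModelPin.lean` (chem-type-10, accepted) renders the ABSOLUTE and SINGLET keys of the row
grammar of record exactly (`PinnedSector.absKey` = `e0[total]@fcidump:<sha8>:Na<a>:Nb<b>`,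
`PinnedSector.singletKey`), but its two DIFFERENCE renderers `PinnedSector.diffKey` /
`PinnedSector.diffKeySectors` insert the `E_core` tag `A.totalTag`, so for a TOTAL-energy pair (the only
kind this cell tables) they print `dE[total]@fcidump:<sha8A>-<sha8B>:Na<a>:Nb<b>` — while the grammar of
record is, verbatim (cell file START-HERE §3.1; CERTIFIED-CHEM.md header l.8): "DIFFERENCE
`dE@fcidump:<sha8A>-<sha8B>:Na<a>:Nb<b>` meaning E₀(H[F_A],N_α,N_β) − E₀(H[F_B],N_α,N_β) (if the two
files live in different sectors: `dE@fcidump:<sha8A>:Na<a>:Nb<b>-<sha8B>:Na<a'>:Nb<b'>`); `<sha8>` =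
first 8 hex of the fcidump sha256 of the `.clean` file that IS the model; energies TOTAL (E_core
convention printed on the row)". The cell referee (chem-ref-4, verdict of 2026-08-26T18:51:55Z,
kernel probe by `decide`) therefore BOUNCED the two renderers: "the decl does not render the key its
own docstring quotes, and a string-equality adjudication of any dE row of record against diffKey
fails. → fix: delete «A.totalTag ++» in both defs (the E_core convention is carried by IsDiffPair / the
row, not by the key)". An accepted file is never edited, so the fix is THIS sibling: the two keys of
record under NEW names, with the bounced renderers left in place and their exact relation stated.

WHAT.
* `PinnedSector.dEKey A B` — `dE@fcidump:<sha8A>-<sha8B>:Na<a>:Nb<b>` (same sector on both files; the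
  sector suffix is read off the FIRST record, a well-formed pair agrees on it: `PinnedSector.IsDiffPair`,
  unchanged, which ALSO carries the agreement of the two `E_core` conventions — that is where the
  convention lives, not in the key).
* `PinnedSector.dEKeySectors A B` — `dE@fcidump:<sha8A>:Na<a>:Nb<b>-<sha8B>:Na<a'>:Nb<b'>` (two sectors,
  e.g. the same-file oxidation / reduction pairs of the electrolyte family: one pin, two sectors).
* Rendering lemmas `dEKey_eq` / `dEKeySectors_eq` (the strings spelled out down to `toString` of the
  four occupation numbers), the kernel probes `dEKey_eq_of_sha8` / `dEKeySectors_eq_of_sha8` (for ANY two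
  records whose `sha8` and sector fields are those of the cell's EX-0 pair resp. of a same-file
  two-sector pair, the rendered key is LITERALLY the string the landed claim node
  `Certificates/N2Sto6gDiffR200Re.lean` l.19 quotes, `dE@fcidump:f43758c2-02f61ad9:Na7:Nb7`, resp.
  `dE@fcidump:3b7bb41c:Na12:Nb11-3b7bb41c:Na12:Nb12` — hypotheses on the fields only, no record of any
  file is declared here), and the DELTA to the bounced renderers: `diffKey_eq_dEKey` /
  `diffKeySectors_eq_dEKeySectors` (they coincide exactly when `E_core` is NOT in the objective) and
  `diffKey_eq_of_total` / `diffKeySectors_eq_of_total` (with `E_core` in the objective the old renderers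
  are the new keys with `[total]` spliced after `dE`).
Locator of the grammar: an in-house convention (cell files START-HERE §3.1, CERTIFIED-CHEM.md l.8, both
extending pub-qchem CERTIFIED.md l.6); the only printed source involved is the FCIDUMP header whose
integers the records quote. [cite: KnowlesHandy1989, §2 (FCIDUMP format)]
-/

namespace Summit.Ventures.CertifiedQuantumChemistry

namespace PinnedSector

/-- **DIFFERENCE row key of record, same sector on both files**:
`dE@fcidump:<sha8A>-<sha8B>:Na<a>:Nb<b>`, meaning `E₀(H[F_A], N_α, N_β) − E₀(H[F_B], N_α, N_β)`
(START-HERE §3.1 verbatim; CERTIFIED-CHEM.md l.8). NO `E_core` tag: "energies TOTAL (E_core convention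
printed on the row)" — the convention is a separate cell of the row and the agreement of the two records
on it is `IsDiffPair`. The sector suffix is read off the first record.
[cite: KnowlesHandy1989, §2 (FCIDUMP format)] -/
def dEKey (A B : PinnedSector) : String :=
  "dE@fcidump:" ++ A.pin.sha8 ++ "-" ++ B.pin.sha8 ++ A.sectorTag

/-- **DIFFERENCE row key of record across sectors**:
`dE@fcidump:<sha8A>:Na<a>:Nb<b>-<sha8B>:Na<a'>:Nb<b'>` (START-HERE §3.1, "if the two files live in
different sectors"; also the shape of a same-file two-sector pair, `sha8A = sha8B`). No `E_core` tag.
[cite: KnowlesHandy1989, §2 (FCIDUMP format)] -/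
def dEKeySectors (A B : PinnedSector) : String :=
  "dE@fcidump:" ++ A.pin.sha8 ++ A.sectorTag ++ "-" ++ B.pin.sha8 ++ B.sectorTag

/-! ### Rendering, spelled out -/

/-- `dEKey` spelled out to the occupation numbers:
`"dE@fcidump:" ++ sha8A ++ "-" ++ sha8B ++ ":Na" ++ toString a ++ ":Nb" ++ toString b`.
[cite: KnowlesHandy1989, §2 (FCIDUMP format)] -/
theorem dEKey_eq (A B : PinnedSector) :
    dEKey A B = "dE@fcidump:" ++ A.pin.sha8 ++ "-" ++ B.pin.sha8 ++
      ":Na" ++ toString A.nalpha ++ ":Nb" ++ toString A.nbeta := by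
  simp only [dEKey, sectorTag, String.append_assoc]

/-- `dEKeySectors` spelled out to the occupation numbers.
[cite: KnowlesHandy1989, §2 (FCIDUMP format)] -/
theorem dEKeySectors_eq (A B : PinnedSector) :
    dEKeySectors A B = "dE@fcidump:" ++ A.pin.sha8 ++ ":Na" ++ toString A.nalpha ++ ":Nb" ++
      toString A.nbeta ++ "-" ++ B.pin.sha8 ++ ":Na" ++ toString B.nalpha ++ ":Nb" ++
      toString B.nbeta := by
  simp only [dEKeySectors, sectorTag, String.append_assoc]

/-! ### Kernel probes on the fields of two keys of record (no record of any file is declared) -/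

/-- **Probe, same-sector key**: for any two records carrying the `sha8` and sector fields of the cell's
EX-0 pair (N₂/STO-6G `R = 2.0 Å` vs `R_e`, `sha8` `f43758c2` / `02f61ad9`, sector `(7, 7)`), `dEKey`
renders LITERALLY the key quoted by the landed claim node `Certificates/N2Sto6gDiffR200Re.lean` l.19,
`dE@fcidump:f43758c2-02f61ad9:Na7:Nb7`. [cite: KnowlesHandy1989, §2 (FCIDUMP format)] -/
theorem dEKey_eq_of_sha8 (A B : PinnedSector) (hA : A.pin.sha8 = "f43758c2")
    (hB : B.pin.sha8 = "02f61ad9") (ha : A.nalpha = 7) (hb : A.nbeta = 7) :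
    dEKey A B = "dE@fcidump:f43758c2-02f61ad9:Na7:Nb7" := by
  rw [dEKey_eq, hA, hB, ha, hb]
  decide

/-- **Probe, two-sector key**: for any two records on ONE pin with `sha8` `3b7bb41c` and sectors
`(12, 11)` / `(12, 12)` (the shape of the electrolyte family's same-file oxidation pair), `dEKeySectors`
renders `dE@fcidump:3b7bb41c:Na12:Nb11-3b7bb41c:Na12:Nb12`.
[cite: KnowlesHandy1989, §2 (FCIDUMP format)] -/
theorem dEKeySectors_eq_of_sha8 (A B : PinnedSector) (hA : A.pin.sha8 = "3b7bb41c")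
    (hB : B.pin.sha8 = "3b7bb41c") (ha : A.nalpha = 12) (hb : A.nbeta = 11) (ha' : B.nalpha = 12)
    (hb' : B.nbeta = 12) :
    dEKeySectors A B = "dE@fcidump:3b7bb41c:Na12:Nb11-3b7bb41c:Na12:Nb12" := by
  rw [dEKeySectors_eq, hA, hB, ha, hb, ha', hb']
  decide

/-! ### Delta to the bounced renderers of `Rows/ModelPin.lean` -/

/-- With `E_core` NOT in the objective (`ecoreInObjective = false`, FORMAT-qcl1 option `no-ecore`) the
bounced renderer `diffKey` and the key of record `dEKey` COINCIDE (the spliced tag is empty).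
[cite: KnowlesHandy1989, §2 (FCIDUMP format)] -/
theorem diffKey_eq_dEKey (A B : PinnedSector) (h : A.ecoreInObjective = false) :
    diffKey A B = dEKey A B := by
  simp only [diffKey, dEKey, totalTag, h, Bool.false_eq_true, ↓reduceIte, String.append_empty,
    String.reduceAppend]

/-- With `E_core` IN the objective (every TOTAL-energy row of the cell) the bounced renderer `diffKey`
is the key of record with `[total]` spliced after `dE` — the defect chem-ref-4's probe exhibited
(`dE[total]@fcidump:f43758c2-02f61ad9:Na7:Nb7`). [cite: KnowlesHandy1989, §2 (FCIDUMP format)] -/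
theorem diffKey_eq_of_total (A B : PinnedSector) (h : A.ecoreInObjective = true) :
    diffKey A B = "dE[total]@fcidump:" ++ A.pin.sha8 ++ "-" ++ B.pin.sha8 ++ A.sectorTag := by
  simp only [diffKey, totalTag, h, ↓reduceIte, String.append_assoc, String.reduceAppend]

/-- Two-sector form: with `E_core` not in the objective, `diffKeySectors = dEKeySectors`.
[cite: KnowlesHandy1989, §2 (FCIDUMP format)] -/
theorem diffKeySectors_eq_dEKeySectors (A B : PinnedSector) (h : A.ecoreInObjective = false) :
    diffKeySectors A B = dEKeySectors A B := by
  simp only [diffKeySectors, dEKeySectors, totalTag, h, Bool.false_eq_true, ↓reduceIte,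
    String.append_empty, String.reduceAppend]

/-- Two-sector form: with `E_core` in the objective, `diffKeySectors` is `dEKeySectors` with `[total]`
spliced after `dE`. [cite: KnowlesHandy1989, §2 (FCIDUMP format)] -/
theorem diffKeySectors_eq_of_total (A B : PinnedSector) (h : A.ecoreInObjective = true) :
    diffKeySectors A B =
      "dE[total]@fcidump:" ++ A.pin.sha8 ++ A.sectorTag ++ "-" ++ B.pin.sha8 ++ B.sectorTag := by
  simp only [diffKeySectors, totalTag, h, ↓reduceIte, String.append_assoc, String.reduceAppend]

end PinnedSector

end Summit.Ventures.CertifiedQuantumChemistry
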